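import Mathlib
import HarnessLib
import Summits.AtomisticToContinuum.Crystallization.Theses.VdwKissingSutherland

/-!
# Birth skeleton — crux `VdwKissingSutherland.VdwKissing` (item stmt-AtomisticToContinuum-12230)

Line `birth` (skeleton-register, planner one-shot, 2026-08-17).  The crux (verbatim, route file
`Theses/VdwKissingSutherland.lean`):

  `∀ X : Finset ℝ³, (∀ x ∈ X, 1 ≤ ‖x‖ ≤ 3/2) → (pairwise dist ≥ 1) → Σ_{x ∈ X} ‖x‖⁻⁶ ≤ 51/4`

— the r⁻⁶-weighted TWO-SHELL kissing inequality, sharp at both Barlow two-shells (12 contacts +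
6 octahedral caps at √2).

## The cut: near-contact count at the buffered radius `26/25`

Let `n(X) = #{x ∈ X : ‖x‖ < 26/25}` (near contacts; `26/25 = 1.04` is below the Tammes-13 radius
`1/(2 sin(δ₁₃/2)) = 1.0455`, `δ₁₃ = 57.1367°`).  Any proof of the crux proves a kissing-number
theorem (thirteen contacts would score `13 > 51/4`), so a count of this kind is an unavoidable
sub-theorem; we isolate it and split the weighted inequality into the two regimes it creates:

* `stub_thirteenSpheres` — ROBUST THIRTEEN SPHERES (Tammes `N = 13` with margin): unit vectors of
  `ℝ³` with pairwise chordal distances `≥ 25/26` (angle `≥ 57.49° > δ₁₃`) number at most `12`.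
  True by Musin–Tarasov 2012 (tree: named fact `musinTarasov2012_tammes_thirteen`, threshold
  `0.957 < 25/26`, via `card_le_twelve_of_tammes_thirteen`); the proved tree theorem
  `musin2006_kissing_three_holds` is the threshold-`1` case only.
* `stub_twelveNearContacts` — the EQUALITY REGIME `n(X) = 12`: twelve near-kissing directions
  (pairwise angle `≥ 57.49°`), every farther point sits over a hole of the dozen; the six
  octahedral caps at `√2` (`6 · 1/8 = 3/4`) are extremal (KKLS configuration space of the dozen,
  hole-depth accounting; contains both Barlow two-shells and their rigidity).
* `stub_contactDeficit` — the SLACK REGIME `n(X) ≤ 11`: at most eleven points weigh more than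
  `(26/25)⁻⁶ = 0.790`; expected supremum `≈ 12.54–12.67 < 51/4` (best known: a Barlow two-shell
  with one contact pushed to radius `26/25`, `12.75 − 0.21`; refuter deep-hole shells `≤ 12.668`),
  i.e. a margin for certificate methods (area / Delsarte–Legendre sums with radius multipliers,
  `Literature.Geometry.DiscreteGeometry.sum_sum_legendreI_nonneg`; interval arithmetic).

`vdwKissing_of_stmts` (sorry-free, hypothesis form `⟨stub 1⟩ → ⟨stub 2⟩ → ⟨stub 3⟩ → crux`) composes
them and `VdwKissing_of : VdwKissing` plugs the stubs in by name: the near contacts, normalised to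
unit vectors, stay `(25/26)`-separated — the law-of-cosines identity `‖x‖‖y‖·‖x/‖x‖ − y/‖y‖‖² = ‖x − y‖² − (‖x‖ − ‖y‖)²`
and the polynomial inequality `rs ≤ (26/25)²(1 − (r − s)²)` on `[1, 26/25]²` — and normalisation is
injective there, so `stub_thirteenSpheres` gives `n(X) ≤ 12`; then trichotomy.  All three stubs are
load-bearing (`= 12` in stub 2 keeps the thirteen-spheres content out of it).

Negatives index: none of the 20 refuted statements of the summit is an instance of a stub (the
nearest, `GappedShellCensus.ShellCensus`, is a tolerance-`1/50` census of twelve-shells; here norms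
are `≥ 1` exactly and no census is claimed).  No `Disproof.lean` exists for this crux yet.
-/

noncomputable section

namespace Summit.AtomisticToContinuum.Crystallization.Cruxes.VdwKissing.Birth

open Summit.AtomisticToContinuum.Crystallization.Theses.VdwKissingSutherland
open scoped BigOperators RealInnerProductSpace

/-! ## Registered stubs -/

/-- **Stub 1 — robust thirteen spheres (Tammes `N = 13` with margin).**  Every finite set of unit
vectors of `ℝ³` with pairwise Euclidean distances `≥ 25/26` (angular separation `≥ 57.49°`) has at
most twelve elements.  (Musin–Tarasov 2012, Theorem 1: `d₁₃ = δ₁₃ ≈ 57.1367°`; tree named fact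
`Literature.Geometry.DiscreteGeometry.musinTarasov2012_tammes_thirteen` has threshold `0.957`.) -/
theorem stub_thirteenSpheres :
    ∀ T : Finset (EuclideanSpace ℝ (Fin 3)), (∀ v ∈ T, ‖v‖ = 1) →
      (∀ v ∈ T, ∀ w ∈ T, v ≠ w → (25 : ℝ) / 26 ≤ dist v w) → T.card ≤ 12 := by
  sorry

/-- **Stub 2 — the equality regime (exactly twelve near contacts).**  If exactly twelve points of
`X` lie in the near-contact shell `1 ≤ ‖x‖ < 26/25`, the weighted two-shell sum is at most `51/4`
(attained by the fcc and hcp two-shells). -/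
theorem stub_twelveNearContacts :
    ∀ X : Finset (EuclideanSpace ℝ (Fin 3)), (∀ x ∈ X, 1 ≤ ‖x‖ ∧ ‖x‖ ≤ 3 / 2) →
      (∀ x ∈ X, ∀ y ∈ X, x ≠ y → 1 ≤ dist x y) →
      (X.filter (fun x => ‖x‖ < 26 / 25)).card = 12 →
      ∑ x ∈ X, ‖x‖⁻¹ ^ 6 ≤ 51 / 4 := by
  sorry

/-- **Stub 3 — the slack regime (at most eleven near contacts).**  If at most eleven points of `X`
lie in the near-contact shell `1 ≤ ‖x‖ < 26/25`, the weighted two-shell sum is at most `51/4`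
(expected with margin `≈ 0.1`). -/
theorem stub_contactDeficit :
    ∀ X : Finset (EuclideanSpace ℝ (Fin 3)), (∀ x ∈ X, 1 ≤ ‖x‖ ∧ ‖x‖ ≤ 3 / 2) →
      (∀ x ∈ X, ∀ y ∈ X, x ≠ y → 1 ≤ dist x y) →
      (X.filter (fun x => ‖x‖ < 26 / 25)).card ≤ 11 →
      ∑ x ∈ X, ‖x‖⁻¹ ^ 6 ≤ 51 / 4 := by
  sorry

/-! ## Assembly (no `sorry` below this line) -/

/-- The polynomial inequality behind the radial normalisation: on `[1, 26/25]²`,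
`r s ≤ (26/25)² (1 − (r − s)²)` (a nonnegative combination of `(R − r)(r − 1)`, `(R − s)(s − 1)`,
`(R − r)(R − s)`, `R − r`, `R − s`, `R = 26/25`). -/
theorem proj_poly {r s : ℝ} (hr1 : 1 ≤ r) (hr2 : r ≤ 26 / 25) (hs1 : 1 ≤ s) (hs2 : s ≤ 26 / 25) :
    r * s ≤ (26 / 25 : ℝ) ^ 2 * (1 - (r - s) ^ 2) := by
  nlinarith [mul_nonneg (sub_nonneg.2 hr2) (sub_nonneg.2 hr1),
    mul_nonneg (sub_nonneg.2 hs2) (sub_nonneg.2 hs1),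
    mul_nonneg (sub_nonneg.2 hr2) (sub_nonneg.2 hs2), sub_nonneg.2 hr2, sub_nonneg.2 hs2]

/-- Law of cosines for the normalised vectors:
`‖x‖ ‖y‖ · dist(x/‖x‖, y/‖y‖)² = dist(x, y)² − (‖x‖ − ‖y‖)²`. -/
theorem normalize_dist_sq {x y : EuclideanSpace ℝ (Fin 3)} (hx : 0 < ‖x‖) (hy : 0 < ‖y‖) :
    ‖x‖ * ‖y‖ * dist (‖x‖⁻¹ • x) (‖y‖⁻¹ • y) ^ 2 = dist x y ^ 2 - (‖x‖ - ‖y‖) ^ 2 := by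
  rw [dist_eq_norm, dist_eq_norm, norm_sub_sq_real, norm_sub_sq_real, norm_smul, norm_smul,
    real_inner_smul_left, real_inner_smul_right, norm_inv, norm_norm, norm_inv, norm_norm]
  field_simp
  ring

/-- Near contacts stay `(25/26)`-separated after normalisation: if `1 ≤ ‖x‖, ‖y‖ ≤ 26/25` and
`dist x y ≥ 1` then `dist (x/‖x‖) (y/‖y‖) ≥ 25/26`. -/
theorem dist_normalize_ge {x y : EuclideanSpace ℝ (Fin 3)}
    (hx1 : 1 ≤ ‖x‖) (hx2 : ‖x‖ ≤ 26 / 25) (hy1 : 1 ≤ ‖y‖) (hy2 : ‖y‖ ≤ 26 / 25)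
    (hxy : 1 ≤ dist x y) :
    (25 : ℝ) / 26 ≤ dist (‖x‖⁻¹ • x) (‖y‖⁻¹ • y) := by
  have hx0 : 0 < ‖x‖ := by linarith
  have hy0 : 0 < ‖y‖ := by linarith
  have key := normalize_dist_sq hx0 hy0
  have hpoly := proj_poly hx1 hx2 hy1 hy2
  have h1 : 1 ≤ dist x y ^ 2 := by nlinarith [hxy]
  have hD : 0 ≤ dist (‖x‖⁻¹ • x) (‖y‖⁻¹ • y) := dist_nonneg
  have hD2 : ((25 : ℝ) / 26) ^ 2 ≤ dist (‖x‖⁻¹ • x) (‖y‖⁻¹ • y) ^ 2 := by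
    have hrs : 0 < ‖x‖ * ‖y‖ := mul_pos hx0 hy0
    have hmul : ‖x‖ * ‖y‖ * ((25 : ℝ) / 26) ^ 2 ≤
        ‖x‖ * ‖y‖ * dist (‖x‖⁻¹ • x) (‖y‖⁻¹ • y) ^ 2 := by
      rw [key]
      nlinarith [hpoly, h1]
    exact le_of_mul_le_mul_left hmul hrs
  nlinarith [hD2, hD]

/-- From the robust thirteen-spheres bound: at most twelve near contacts.  The near contacts,
normalised, are unit vectors with pairwise distances `≥ 25/26` (and normalisation is injective on
them), so `stub_thirteenSpheres` applies. -/
theorem nearContact_card_le_twelve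
    (h13 : ∀ T : Finset (EuclideanSpace ℝ (Fin 3)), (∀ v ∈ T, ‖v‖ = 1) →
      (∀ v ∈ T, ∀ w ∈ T, v ≠ w → (25 : ℝ) / 26 ≤ dist v w) → T.card ≤ 12)
    (X : Finset (EuclideanSpace ℝ (Fin 3))) (hX : ∀ x ∈ X, 1 ≤ ‖x‖ ∧ ‖x‖ ≤ 3 / 2)
    (hsep : ∀ x ∈ X, ∀ y ∈ X, x ≠ y → 1 ≤ dist x y) :
    (X.filter (fun x => ‖x‖ < 26 / 25)).card ≤ 12 := by
  classical
  have hmem : ∀ x ∈ X.filter (fun x => ‖x‖ < 26 / 25), 1 ≤ ‖x‖ ∧ ‖x‖ ≤ 26 / 25 ∧ x ∈ X := by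
    intro x hx
    rw [Finset.mem_filter] at hx
    exact ⟨(hX x hx.1).1, hx.2.le, hx.1⟩
  have hfar : ∀ x ∈ X.filter (fun x => ‖x‖ < 26 / 25), ∀ y ∈ X.filter (fun x => ‖x‖ < 26 / 25),
      x ≠ y → (25 : ℝ) / 26 ≤ dist (‖x‖⁻¹ • x) (‖y‖⁻¹ • y) := by
    intro x hx y hy hxy
    obtain ⟨hx1, hx2, hxX⟩ := hmem x hx
    obtain ⟨hy1, hy2, hyX⟩ := hmem y hy
    exact dist_normalize_ge hx1 hx2 hy1 hy2 (hsep x hxX y hyX hxy)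
  have hinj : Set.InjOn (fun x : EuclideanSpace ℝ (Fin 3) => ‖x‖⁻¹ • x)
      ↑(X.filter (fun x => ‖x‖ < 26 / 25)) := by
    intro x hx y hy hxy
    by_contra hne
    have h := hfar x (Finset.mem_coe.1 hx) y (Finset.mem_coe.1 hy) hne
    have h0 : dist (‖x‖⁻¹ • x) (‖y‖⁻¹ • y) = 0 := by
      rw [dist_eq_zero]
      exact hxy
    rw [h0] at h
    norm_num at h
  rw [← Finset.card_image_of_injOn hinj]
  refine h13 _ ?_ ?_
  · intro v hv
    obtain ⟨x, hx, rfl⟩ := Finset.mem_image.1 hv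
    have hx0 : ‖x‖ ≠ 0 := by
      have := (hmem x hx).1
      intro h0
      rw [h0] at this
      norm_num at this
    rw [norm_smul, norm_inv, norm_norm, inv_mul_cancel₀ hx0]
  · intro v hv w hw hvw
    obtain ⟨x, hx, rfl⟩ := Finset.mem_image.1 hv
    obtain ⟨y, hy, rfl⟩ := Finset.mem_image.1 hw
    exact hfar x hx y hy (fun h => hvw (by rw [h]))

/-- **Composition over the stub STATEMENTS** (hypothesis form, sorry-free, standard axioms):
`⟨stub 1⟩ → ⟨stub 2⟩ → ⟨stub 3⟩ → ⟨the crux, unfolded⟩`.  The near-contact count is `≤ 12` by the first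
hypothesis (through `nearContact_card_le_twelve`), and the two regimes `= 12` / `≤ 11` are the other
two.  (Conclusion written out rather than by name so that `VdwKissing_of` below is the unique theorem of
this file concluding the route decl.) -/
theorem vdwKissing_of_stmts :
    (∀ T : Finset (EuclideanSpace ℝ (Fin 3)), (∀ v ∈ T, ‖v‖ = 1) →
      (∀ v ∈ T, ∀ w ∈ T, v ≠ w → (25 : ℝ) / 26 ≤ dist v w) → T.card ≤ 12) →
    (∀ X : Finset (EuclideanSpace ℝ (Fin 3)), (∀ x ∈ X, 1 ≤ ‖x‖ ∧ ‖x‖ ≤ 3 / 2) →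
      (∀ x ∈ X, ∀ y ∈ X, x ≠ y → 1 ≤ dist x y) →
      (X.filter (fun x => ‖x‖ < 26 / 25)).card = 12 →
      ∑ x ∈ X, ‖x‖⁻¹ ^ 6 ≤ 51 / 4) →
    (∀ X : Finset (EuclideanSpace ℝ (Fin 3)), (∀ x ∈ X, 1 ≤ ‖x‖ ∧ ‖x‖ ≤ 3 / 2) →
      (∀ x ∈ X, ∀ y ∈ X, x ≠ y → 1 ≤ dist x y) →
      (X.filter (fun x => ‖x‖ < 26 / 25)).card ≤ 11 →
      ∑ x ∈ X, ‖x‖⁻¹ ^ 6 ≤ 51 / 4) →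
    ∀ X : Finset (EuclideanSpace ℝ (Fin 3)), (∀ x ∈ X, 1 ≤ ‖x‖ ∧ ‖x‖ ≤ 3 / 2) →
      (∀ x ∈ X, ∀ y ∈ X, x ≠ y → 1 ≤ dist x y) → ∑ x ∈ X, ‖x‖⁻¹ ^ 6 ≤ 51 / 4 := by
  intro h13 h12 h11 X hX hsep
  have hcard : (X.filter (fun x => ‖x‖ < 26 / 25)).card ≤ 12 :=
    nearContact_card_le_twelve h13 X hX hsep
  rcases Nat.lt_or_ge (X.filter (fun x => ‖x‖ < 26 / 25)).card 12 with hlt | hge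
  · exact h11 X hX hsep (by omega)
  · exact h12 X hX hsep (le_antisymm hcard hge)

/-- **THE SKELETON — the crux BY NAME from the registered stubs BY NAME.**
`VdwKissing_of : VdwKissingSutherland.VdwKissing`, the kernel-checked composition
`vdwKissing_of_stmts stub_thirteenSpheres stub_twelveNearContacts stub_contactDeficit`; the only
`sorry`s in its cone are the three stubs. -/
theorem VdwKissing_of : VdwKissing :=
  vdwKissing_of_stmts stub_thirteenSpheres stub_twelveNearContacts stub_contactDeficit

end Summit.AtomisticToContinuum.Crystallization.Cruxes.VdwKissing.Birth

end
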